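import Literature.NumberTheory.EllipticCurves.Curve5077aLambdaThirdDerivPos
import Literature.NumberTheory.EllipticCurves.CuspFormLThirdDerivativeSeries
import Literature.NumberTheory.EllipticCurves.QuadraticTwistLDerivativeSeries
import HarnessLib

/-!
# The curve 5077a: `ord_{s=1} L(E, s) ≤ 3` from modularity alone, and `= 3` with Gross–Zagier–Kolyvagin

Buhler–Gross–Zagier 1985, §4: for `E = 5077a`, `L‴(E,1)/3! = 1.7318… ≠ 0` ((14)), so
`ord_{s=1} L(E,s) ≤ 3`; with `ord ≥ 3` (odd sign, two independent points, Gross–Zagier–Kolyvagin)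
`ord_{s=1} L(E,s) = 3` exactly — the input of Gross–Zagier's solution of Gauss's class number problem
(Goldfeld 1976, Oesterlé 1985). This file closes the UPPER bound in the tree with NO numerical
hypothesis: the Modularity Theorem (`exists_isNewformOf`) attaches the newform `f = f_E` of level
`N_E = 5077` with `w_N f = f` (`rootNumber_E`, `frickeInvolution_eq_self_of_rootNumber_eq_neg_one`);
its completed `L`-function `Λ` satisfies `Λ‴(1) = 2 ∑ aₙ(E) ∫_1^∞ e^{-2πny/√5077}(log y)³ dy`
(Cremona (2.13.1), `r = 3`: `hasSum_iteratedDeriv_three_completedCuspFormL_continuation_one_integral`)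
whose right-hand side is `> 0` by the kernel certificate `bgzSum_pos`; hence `Λ‴(1) ≠ 0`, so the
order of `Λ` at `1` is `≤ 3`, and `r_an(E) = ord_{s=1} Λ` (`IsNewformOf.analyticRank_eq_order_holds`).
No step uses `L‴(E,1)` or `Λ′(E,1) = 0`; Gross–Zagier–Kolyvagin enters only the lower bound.

* `iteratedDeriv_three_completedCuspFormL_ne_zero` — `Λ‴(f_E, 1) ≠ 0` for the newform of `E`;
* `analyticRank_E_le_three_of_modularity (hmod) : E.analyticRank ≤ 3`;
* `analyticRank_E_eq_three_of_modularity_GZK (hmod) (hGZK) : E.analyticRank = 3`;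
* `iteratedDeriv_three_entireLFunction_E_ne_zero (hmod) (hGZK)` — the former numerical hypothesis
  `h3 : L‴(E,1) ≠ 0` of `analyticRank_E_eq_three'`, now a theorem.

Named facts used: `exists_isNewformOf` (Modularity: Wiles 1995, BCDT 2001) throughout;
`rank_eq_analyticRank_of_analyticRank_le_one` (Gross–Zagier 1986 + Kolyvagin 1990) for `= 3` only.

## References
* J. P. Buhler, B. H. Gross, D. B. Zagier, *On the conjecture of Birch and Swinnerton-Dyer for an
  elliptic curve of rank 3*, Math. Comp. 44 (1985) 473–481, §4 (11), (14). [BuhlerGrossZagier1985]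
* J. E. Cremona, *Algorithms for Modular Elliptic Curves*, 2nd ed. (1997), §2.13. [CremonaAlgorithms1997]
* B. H. Gross, D. B. Zagier, *Heegner points and derivatives of `L`-series*, Invent. Math. 84 (1986),
  (8.2)–(8.3). [GrossZagier1986]
-/

noncomputable section

open scoped MatrixGroups ModularForm

open CongruenceSubgroup UpperHalfPlane Complex Filter Topology Set MeasureTheory
open Literature.Analysis.ValidatedNumerics.ExpLogCube
open Literature.NumberTheory.EllipticCurves.ModularForms

namespace Literature.NumberTheory.EllipticCurves.Curve5077a

open WeierstrassCurve

/-- `N_E = 5077 ≠ 0` (the level of the newform; used as a local instance). [cite: BuhlerGrossZagier1985, §1 (p. 473)] -/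
theorem neZero_conductorNorm_E : NeZero (E.conductorNorm ℤ) :=
  ⟨by rw [conductorNorm_E]; norm_num⟩

/-- **`Λ‴(f_E, 1) ≠ 0`**: for the newform `f` attached to `5077a` (any `f` with `IsNewformOf E f`)
and the entire continuation `Λ` of `Λ_N(f, s)`, the third derivative at `s = 1` is the positive real
number `2 ∑ aₙ(E) ∫_1^∞ e^{-2πny/√5077}(log y)³ dy` (BGZ (11), (14); Cremona (2.13.1), `r = 3`;
kernel certificate `bgzSum_pos`). [cite: BuhlerGrossZagier1985, §4 (14)] -/
theorem iteratedDeriv_three_completedCuspFormL_ne_zero (hmod : exists_isNewformOf)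
    [NeZero (E.conductorNorm ℤ)]
    {f : CuspForm (Gamma0 (E.conductorNorm ℤ)) 2} (hf : IsNewformOf E f) {Λ : ℂ → ℂ}
    (hΛ : Λ ∈ completedCuspFormLContinuations (E.conductorNorm ℤ) f) :
    iteratedDeriv 3 Λ 1 ≠ 0 := by
  have hfix := frickeInvolution_eq_self_of_rootNumber_eq_neg_one E hf (rootNumber_E hmod)
  have hsum := hasSum_iteratedDeriv_three_completedCuspFormL_continuation_one_integral hfix hΛ
  have hN : ((E.conductorNorm ℤ : ℕ) : ℝ) = 5077 := by rw [conductorNorm_E]; norm_num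
  simp_rw [hf.2, hN] at hsum
  -- the summands are real: `2 aₙ I(n)`
  have hsum' : HasSum (fun n : ℕ ↦ (((2 * ((E.LFunction n : ℝ) *
      logCubeIntegral (2 * Real.pi * (n : ℝ) * (Real.sqrt 5077)⁻¹))) : ℝ) : ℂ))
      (iteratedDeriv 3 Λ 1) := by
    convert hsum using 2 with n
    unfold logCubeIntegral
    push_cast
    ring_nf
  have hre := Complex.hasSum_re hsum'
  simp only [Complex.ofReal_re] at hre
  have hval : (iteratedDeriv 3 Λ 1).re = 2 * ∑' n : ℕ, (E.LFunction n : ℝ) *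
      logCubeIntegral (2 * Real.pi * (n : ℝ) * (Real.sqrt 5077)⁻¹) := by
    rw [← hre.tsum_eq, tsum_mul_left]
  intro h0
  have h := bgzSum_pos
  rw [h0, Complex.zero_re] at hval
  linarith

/-- **`ord_{s=1} L(5077a, s) ≤ 3` from the Modularity Theorem alone** (no Gross–Zagier–Kolyvagin,
no numerical hypothesis): `r_an(E)` is the order at `1` of the completed `Λ` of the newform
(`IsNewformOf.analyticRank_eq_order_holds`), and an analytic function with `Λ‴(1) ≠ 0` has order
`≤ 3` there (`iteratedDeriv_eq_zero_of_lt_analyticOrderNatAt`). BGZ (14). [cite: BuhlerGrossZagier1985, §4 (14)] -/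
theorem analyticRank_E_le_three_of_modularity (hmod : exists_isNewformOf) : E.analyticRank ≤ 3 := by
  haveI := neZero_conductorNorm_E
  obtain ⟨f, hf⟩ := hmod E
  have hΛ := cpow_mul_mellin_mem_completedCuspFormLContinuations_two f
  have hne := iteratedDeriv_three_completedCuspFormL_ne_zero hmod hf hΛ
  have hord := IsNewformOf.analyticRank_eq_order_holds hf hΛ
  rw [hord]
  by_contra h
  exact hne (Literature.Barriers.BirchSwinnertonDyer.iteratedDeriv_eq_zero_of_lt_analyticOrderNatAt
    (by omega))

/-- **`ord_{s=1} L(5077a, s) = 3`** from exactly two named facts — the Modularity Theorem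
(`exists_isNewformOf`) and Gross–Zagier–Kolyvagin (`rank_eq_analyticRank_of_analyticRank_le_one`) —
everything else (three independent points, the sign `w = −1`, the conductor, and now the upper bound
`Λ‴(E,1) ≠ 0` by a kernel-checked enclosure) being theorems of the tree. This is the analytic input
«`L` has a triple zero at `s = 1`» of Goldfeld–Gross–Zagier–Oesterlé's effective class number bound.
[cite: BuhlerGrossZagier1985, §4 (14)] [cite: GrossZagier1986, (8.2)–(8.3)] -/
theorem analyticRank_E_eq_three_of_modularity_GZK (hmod : exists_isNewformOf)
    (hGZK : rank_eq_analyticRank_of_analyticRank_le_one) : E.analyticRank = 3 :=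
  analyticRank_E_eq_three hmod hGZK (analyticRank_E_le_three_of_modularity hmod)

/-- The former numerical hypothesis `h3 : L‴(E,1) ≠ 0` of `analyticRank_E_eq_three'`, now a theorem
(given modularity and GZK): an analytic function of order exactly `3` at `1` has non-vanishing third
derivative there. [cite: BuhlerGrossZagier1985, §4 (14)] -/
theorem iteratedDeriv_three_entireLFunction_E_ne_zero (hmod : exists_isNewformOf)
    (hGZK : rank_eq_analyticRank_of_analyticRank_le_one) :
    iteratedDeriv 3 E.entireLFunction 1 ≠ 0 := by
  have h3 := analyticRank_E_eq_three_of_modularity_GZK hmod hGZK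
  haveI := neZero_conductorNorm_E
  obtain ⟨f, hf⟩ := hmod E
  have hE : E.HasEntireLFunction := hf.hasEntireLFunction
  have han : AnalyticAt ℂ E.entireLFunction 1 :=
    (E.differentiable_entireLFunction hE).analyticAt 1
  intro h0
  -- all derivatives of order `< 4` vanish, so the analytic order is `≥ 4`
  have hlow : ∀ k < 3, iteratedDeriv k E.entireLFunction 1 = 0 := fun k hk ↦
    Literature.Barriers.BirchSwinnertonDyer.iteratedDeriv_entireLFunction_eq_zero_of_lt_analyticRank
      E (by omega)
  have hall : ∀ k < 4, iteratedDeriv k E.entireLFunction 1 = 0 := by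
    intro k hk
    rcases Nat.lt_succ_iff_lt_or_eq.mp hk with hk | rfl
    · exact hlow k hk
    · exact h0
  have hle : ((4 : ℕ) : ℕ∞) ≤ analyticOrderAt E.entireLFunction 1 :=
    (natCast_le_analyticOrderAt_iff_iteratedDeriv_eq_zero han).2 hall
  -- but the order is the analytic rank `3`
  have htop : analyticOrderAt E.entireLFunction 1 ≠ ⊤ := by
    intro h
    have h0' : E.analyticRank = 0 := by
      simp [WeierstrassCurve.analyticRank, analyticOrderNatAt, h]
    omega
  have hcoe : ((E.analyticRank : ℕ) : ℕ∞) = analyticOrderAt E.entireLFunction 1 := by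
    unfold WeierstrassCurve.analyticRank
    exact Nat.cast_analyticOrderNatAt htop
  rw [← hcoe, h3] at hle
  exact absurd (by exact_mod_cast hle : (4 : ℕ) ≤ 3) (by norm_num)

end Literature.NumberTheory.EllipticCurves.Curve5077a

end
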